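import Summits.HodgeConjecture.HodgeConjecture.Theorems.F0AlbCmBettiLevelRecordTransportHodge
import Summits.HodgeConjecture.HodgeConjecture.Theorems.F0AlbCmS1LevelRealisationTyped
import Summits.HodgeConjecture.CorCM.HypLiu418.A3Liu418GSInstance
import Literature.NumberTheory.Automorphic.Liu2021.AppendixC.BettiPinningRealisation
import Literature.NumberTheory.Automorphic.Liu2021.AppendixC.EtaleBettiComparison
import Literature.NumberTheory.Automorphic.UnitaryCurveCohCotangentForms
import Literature.AlgebraicGeometry.HodgeTheory.HodgeTypeConjugateEmbedding
import HarnessLib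

/-!
# Crux `HLiu418`, line `F0_AlbCm`, sub-sub-line `F0_AlbCmS1bHodge` — the stub `stub_S1_realisationHodge : S1RealisationHodgeShape` CLOSED
# MODULO the Deligne transport (A1) and the TYPED levelwise realisation (S1-R♭♯)

Floor-0 programme P5 (Alb-CM), seat F0P5-p04 (g0 author; g2 filer, v2 = v1 0c7c6d92 + §2); crux item stmt-HodgeConjecture-24832 (`HCCMUnconditional.HLiu418`).
THEOREMS ONLY (no `def`, no named fact, no instance, no `sorry`).  HC_CM is proved only modulo the 7 printed citations until rung 0
closes; this file closes, BY ITS TEXT, the stub `stub_S1_realisationHodge : S1RealisationHodgeShape` of `Cruxes/HLiu418/Lines/F0_AlbCmS1bHodge.lean`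
(ED. 2, tree ff31971c :84–:119) modulo TWO hypotheses taken BY SHAPE:
* `hA1 : ConjEmbedding.isOfHodgeType_conj_iff` — the ★ NAMED FACT [Deligne1979Valeurs, 0.2.5] (`Literature/…/HodgeTypeConjugateEmbedding`, p797145;
  kernel K-A1 in flight, F0P5-p02), consumed through ★ `BettiLevelRecordTransportHodge.exists_bettiLevelRecordTransport_hodge` (p797708): the GS Betti
  levels embed Hecke-naturally into the record's `H¹((M_K ⊗_{ι₁} ℂ)(ℂ); ℂ)` with Hodge types REVERSED along every test morphism;
* `hL` — the TYPED LEVELWISE REALISATION OF A TRANSPORT (S1-R♭♯; F0P5-p01's M5-glue head `levelRealisation_of_transport`, desk interface (a)(b)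
  2026-08-31T00:17:06Z): for ANY injective Hecke-natural transport `tr` of the GS Betti levels into the record's `H¹`, injective `cohForms₂ 𝔣`-valued
  Hecke-compatible level maps `f_K` whose values on classes whose record image is of type `(1,0)` (resp. `(0,1)`) along every test morphism from a
  smooth projective `Z` lie in the holomorphic cone forms `holCotForms₂ 𝔣` (resp. their conjugates) when Mathlib's embedding of the place of `ι₁`
  is `ι₁`, and the other way round when it is `ῑ₁` ([Liu2021, §D.2 (D.1)] at finite level + [VoisinHodgeI2002, Cor. 7.6] on the pieces + the cone
  lift, A-p14's ★ `lift_mem_holCotForms₂_of_embedding_eq` ∕ `conjFun₂_lift_mem_holCotForms₂_of_embedding_ne`, p797007).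
PROOF: glue the level family along the pinning WITH the level identities `r (b_K y) = f_K y` (★ `Sec42Data.BettiPinning.exists_realisation_of_levelFamily`,
p795030), at the transport `tr′` of p797708; a GS class `y` of type `(1,0)` (resp. `(0,1)`) on `A_K ⊗_{ι₁} ℂ` has record images of type `(0,1)`
(resp. `(1,0)`) on every test `Z` (4th conjunct of p797708), whence the four clauses of the letter (the `(cmPlace F ι₁).1.embedding` case split is
carried, not decided).  Conclusion = the TYPE of `stub_S1_realisationHodge` TOKEN FOR TOKEN (same `open`s as the line file).
§2 (v2): `hL` DISCHARGED by ★ (T2′) `S1LevelRealisationTyped.levelRealisation_of_transport` (F0P5-p01, p798192), giving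
`stub_S1_realisationHodge_of_A1 (hA1) : ‹S1RealisationHodgeShape body›` — the stub closes modulo the (A1) named fact ALONE (retired by
`ConjEmbedding.isOfHodgeType_conj_iff_holds`, kernel K-A1, F0P5-p02, when it lands).

## References
* [Liu2021] Y. Liu, *Fourier–Jacobi cycles and arithmetic relative trace formula*, Camb. J. Math. 9 (2021): §D.2 (D.1) l. 5300–5359, §4.2
  l. 2066–2081, Lem. 2.4 (1).
* [Deligne1979Valeurs] P. Deligne, *Valeurs de fonctions L et périodes d'intégrales*, PSPM 33.2 (1979), 0.2.5 p. 315.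
* [VoisinHodgeI2002] C. Voisin, *Hodge Theory and Complex Algebraic Geometry I* (2002), Cor. 7.6, §7.3.2.
* [BorelWallach2000] A. Borel, N. Wallach, *Continuous cohomology, discrete subgroups, and representations of reductive groups*, XIII 1.2.
-/

set_option autoImplicit false
set_option linter.dupNamespace false  -- `Summit.HodgeConjecture.HodgeConjecture.…` BY DESIGN (D-0017)

noncomputable section

namespace Summit.HodgeConjecture.HodgeConjecture.Cruxes.HLiu418.F0AlbCmS1RealisationHodge

open scoped TensorProduct Matrix NumberField ComplexOrder
open CategoryTheory NumberField NumberField.InfinitePlace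
open Literature.AlgebraicGeometry.Motives (CMType AbelianVariety SchemeOver baseChangeHom IsSmoothProjective)
open Literature.AlgebraicGeometry.HodgeTheory (complexBetti ConjEmbedding.isOfHodgeType_conj_iff)
open Literature.AlgebraicGeometry.ShimuraVarieties Literature.AlgebraicGeometry.ShimuraVarieties.UnitaryCanonicalModel
open Literature.NumberTheory.Automorphic Literature.NumberTheory.Automorphic.UnitaryGroup Literature.NumberTheory.Automorphic.UnitaryCurveForms
open Literature.NumberTheory.Automorphic.Liu2021 Literature.NumberTheory.Automorphic.Liu2021.AppendixC
open Summit.HodgeConjecture.CorCM (CMField)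
open Summit.HodgeConjecture.CorCM.Lines.A3Liu418

/-! ## §1 The closer with the transport realisation as a hypothesis -/

set_option maxHeartbeats 400000 in  -- instance-path defeq `(sec42DataGS S h4 isoₛ).G ≡ ↥(finAdelic … Jstar)`, as in the parent's junction
/-- **`stub_S1_realisationHodge` FROM (A1) AND THE TYPED LEVELWISE REALISATION OF A TRANSPORT.**  Conclusion = the TYPE of
`stub_S1_realisationHodge : S1RealisationHodgeShape` of `Cruxes/HLiu418/Lines/F0_AlbCmS1bHodge.lean` ED. 2 (ff31971c :84–:119) TOKEN FOR TOKEN.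
Proof in the module docstring. [cite: Liu2021, §D.2 (D.1) l. 5300–5359; §4.2 l. 2074–2081] [cite: Deligne1979Valeurs, 0.2.5 (p. 315)]
[cite: VoisinHodgeI2002, Cor. 7.6 and §7.3.2] [cite: BorelWallach2000, XIII 1.2] -/
theorem stub_S1_realisationHodge_of (hA1 : ConjEmbedding.isOfHodgeType_conj_iff)
    (hL : ∀ (F : CMField) (ι₁ : F →+* ℂ) (Jstar : Matrix (Fin 2) (Fin 2) (F : Type))
      (K₀ : C5.OpenCompactSubgroup ↥(finAdelic ↥(maximalRealSubfield (F : Type)) (F : Type) (IsCMField.complexConj (F : Type)) 2 Jstar))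
      (S : RecordSystemGS (F : Type) Jstar ι₁ K₀) (hU7ₛ : S.HeckeTranslateDefinedOver)
      (h4 : 4 ≤ Module.finrank ℚ (F : Type)) (isoₛ : ℕ → Prop)
      (𝔣 : ConeFrame (F : Type) Jstar (cmPlace (F : Type) ι₁))
      (tr : ∀ K : C5.SmallLevel K₀,
        (sec42DataGS S h4 isoₛ).bettiH1 ι₁ K →ₗ[ℂ] complexBetti ((baseChangeHom ι₁).obj (S.M.obj K)) 1),
      (∀ K, Function.Injective (tr K)) →
      (∀ (g : (sec42DataGS S h4 isoₛ).G) (K K' : C5.SmallLevel K₀) (h : C5.HeckeLE g K K')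
          (y : (sec42DataGS S h4 isoₛ).bettiH1 ι₁ K'),
          tr K (bettiPullAlong ι₁ ((sec42HeckeTranslatesGS S hU7ₛ h4 isoₛ).albTr g K K' h) y) =
            (complexBetti.map ((baseChangeHom ι₁).map (recordHeckeTranslateGS S hU7ₛ g K K' h)) 1).hom (tr K' y)) →
      ∃ f : ∀ K : C5.SmallLevel K₀,
          (sec42DataGS S h4 isoₛ).bettiH1 ι₁ K →ₗ[ℂ]
            ((adelicGroupData ↥(maximalRealSubfield (F : Type)) (F : Type) (IsCMField.complexConj (F : Type)) 2 Jstar).Adelic → ℂ),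
        (∀ (K : C5.SmallLevel K₀) (y : (sec42DataGS S h4 isoₛ).bettiH1 ι₁ K),
            f K y ∈ cohForms₂ ↥(maximalRealSubfield (F : Type)) (F : Type) (IsCMField.complexConj (F : Type)) Jstar
              (IsCMField.complexConj_ne_one (F : Type)) (UnitaryGroup.complexConj_smul_infinitePlace (F : Type)) (cmPlace (F : Type) ι₁) 𝔣) ∧
        (∀ K : C5.SmallLevel K₀, Function.Injective (f K)) ∧
        (∀ (g : (sec42DataGS S h4 isoₛ).G) (K K' : C5.SmallLevel K₀) (h : C5.HeckeLE g K K')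
            (y : (sec42DataGS S h4 isoₛ).bettiH1 ι₁ K'),
            f K (bettiPullAlong ι₁ ((sec42HeckeTranslatesGS S hU7ₛ h4 isoₛ).albTr g K K' h) y) =
              rightRep₂ ↥(maximalRealSubfield (F : Type)) (F : Type) (IsCMField.complexConj (F : Type)) Jstar g (f K' y)) ∧
        ∀ (K : C5.SmallLevel K₀) (y : (sec42DataGS S h4 isoₛ).bettiH1 ι₁ K),
          ((cmPlace (F : Type) ι₁).1.embedding = ι₁ →
            ((∀ (Z : SchemeOver ℂ) (d : ℕ), IsSmoothProjective d Z → ∀ φ : Z ⟶ (baseChangeHom ι₁).obj (S.M.obj K),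
                Literature.AlgebraicGeometry.HodgeTheory.IsOfHodgeType d Z 1 1 0 ((complexBetti.map φ 1).hom (tr K y))) →
              f K y ∈ holCotForms₂ ↥(maximalRealSubfield (F : Type)) (F : Type) (IsCMField.complexConj (F : Type)) Jstar
              (IsCMField.complexConj_ne_one (F : Type)) (UnitaryGroup.complexConj_smul_infinitePlace (F : Type)) (cmPlace (F : Type) ι₁) 𝔣) ∧
            ((∀ (Z : SchemeOver ℂ) (d : ℕ), IsSmoothProjective d Z → ∀ φ : Z ⟶ (baseChangeHom ι₁).obj (S.M.obj K),
                Literature.AlgebraicGeometry.HodgeTheory.IsOfHodgeType d Z 1 0 1 ((complexBetti.map φ 1).hom (tr K y))) →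
              f K y ∈ (holCotForms₂ ↥(maximalRealSubfield (F : Type)) (F : Type) (IsCMField.complexConj (F : Type)) Jstar
              (IsCMField.complexConj_ne_one (F : Type)) (UnitaryGroup.complexConj_smul_infinitePlace (F : Type)) (cmPlace (F : Type) ι₁) 𝔣).map (conjFun₂ ↥(maximalRealSubfield (F : Type)) (F : Type) (IsCMField.complexConj (F : Type)) Jstar))) ∧
          ((cmPlace (F : Type) ι₁).1.embedding ≠ ι₁ →
            ((∀ (Z : SchemeOver ℂ) (d : ℕ), IsSmoothProjective d Z → ∀ φ : Z ⟶ (baseChangeHom ι₁).obj (S.M.obj K),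
                Literature.AlgebraicGeometry.HodgeTheory.IsOfHodgeType d Z 1 1 0 ((complexBetti.map φ 1).hom (tr K y))) →
              f K y ∈ (holCotForms₂ ↥(maximalRealSubfield (F : Type)) (F : Type) (IsCMField.complexConj (F : Type)) Jstar
              (IsCMField.complexConj_ne_one (F : Type)) (UnitaryGroup.complexConj_smul_infinitePlace (F : Type)) (cmPlace (F : Type) ι₁) 𝔣).map (conjFun₂ ↥(maximalRealSubfield (F : Type)) (F : Type) (IsCMField.complexConj (F : Type)) Jstar)) ∧
            ((∀ (Z : SchemeOver ℂ) (d : ℕ), IsSmoothProjective d Z → ∀ φ : Z ⟶ (baseChangeHom ι₁).obj (S.M.obj K),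
                Literature.AlgebraicGeometry.HodgeTheory.IsOfHodgeType d Z 1 0 1 ((complexBetti.map φ 1).hom (tr K y))) →
              f K y ∈ holCotForms₂ ↥(maximalRealSubfield (F : Type)) (F : Type) (IsCMField.complexConj (F : Type)) Jstar
              (IsCMField.complexConj_ne_one (F : Type)) (UnitaryGroup.complexConj_smul_infinitePlace (F : Type)) (cmPlace (F : Type) ι₁) 𝔣))) :
    ∀ (F : CMField) (ι₁ : F →+* ℂ) (Jstar : Matrix (Fin 2) (Fin 2) (F : Type))
      (K₀ : C5.OpenCompactSubgroup ↥(finAdelic ↥(maximalRealSubfield (F : Type)) (F : Type) (IsCMField.complexConj (F : Type)) 2 Jstar))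
      (S : RecordSystemGS (F : Type) Jstar ι₁ K₀) (hU7ₛ : S.HeckeTranslateDefinedOver)
      (h4 : 4 ≤ Module.finrank ℚ (F : Type)) (isoₛ : ℕ → Prop)
      (H : Type) [AddCommGroup H] [Module ℂ H] (rhoB : Representation ℂ (sec42DataGS S h4 isoₛ).G H)
      (B : (sec42DataGS S h4 isoₛ).BettiPinning (sec42HeckeTranslatesGS S hU7ₛ h4 isoₛ) ι₁ H rhoB)
      (𝔣 : ConeFrame (F : Type) Jstar (cmPlace (F : Type) ι₁)),
      ∃ r : H →ₗ[ℂ] ((adelicGroupData ↥(maximalRealSubfield (F : Type)) (F : Type) (IsCMField.complexConj (F : Type)) 2 Jstar).Adelic → ℂ),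
        Function.Injective r ∧
        (∀ x : H, r x ∈ cohForms₂ ↥(maximalRealSubfield (F : Type)) (F : Type) (IsCMField.complexConj (F : Type)) Jstar
            (IsCMField.complexConj_ne_one (F : Type)) (UnitaryGroup.complexConj_smul_infinitePlace (F : Type))
            (cmPlace (F : Type) ι₁) 𝔣) ∧
        (∀ (g : (sec42DataGS S h4 isoₛ).G) (x : H),
          r (rhoB g x) = rightRep₂ ↥(maximalRealSubfield (F : Type)) (F : Type) (IsCMField.complexConj (F : Type)) Jstar g (r x)) ∧
        letI : Algebra (F : Type) ℂ := algebraAlong (F : Type) ι₁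
        ∀ (K : C5.SmallLevel K₀) (y : (sec42DataGS S h4 isoₛ).bettiH1 ι₁ K),
          ((cmPlace (F : Type) ι₁).1.embedding = ι₁ →
            (Literature.AlgebraicGeometry.HodgeTheory.IsOfHodgeType ((sec42DataGS S h4 isoₛ).A K).dim
                (((sec42DataGS S h4 isoₛ).A K).baseChange ℂ).X 1 1 0 y → r (B.b K y) ∈ (holCotForms₂ ↥(maximalRealSubfield (F : Type)) (F : Type) (IsCMField.complexConj (F : Type)) Jstar
            (IsCMField.complexConj_ne_one (F : Type)) (UnitaryGroup.complexConj_smul_infinitePlace (F : Type))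
            (cmPlace (F : Type) ι₁) 𝔣).map (conjFun₂ ↥(maximalRealSubfield (F : Type)) (F : Type) (IsCMField.complexConj (F : Type)) Jstar)) ∧
            (Literature.AlgebraicGeometry.HodgeTheory.IsOfHodgeType ((sec42DataGS S h4 isoₛ).A K).dim
                (((sec42DataGS S h4 isoₛ).A K).baseChange ℂ).X 1 0 1 y → r (B.b K y) ∈ holCotForms₂ ↥(maximalRealSubfield (F : Type)) (F : Type) (IsCMField.complexConj (F : Type)) Jstar
            (IsCMField.complexConj_ne_one (F : Type)) (UnitaryGroup.complexConj_smul_infinitePlace (F : Type))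
            (cmPlace (F : Type) ι₁) 𝔣)) ∧
          ((cmPlace (F : Type) ι₁).1.embedding ≠ ι₁ →
            (Literature.AlgebraicGeometry.HodgeTheory.IsOfHodgeType ((sec42DataGS S h4 isoₛ).A K).dim
                (((sec42DataGS S h4 isoₛ).A K).baseChange ℂ).X 1 1 0 y → r (B.b K y) ∈ holCotForms₂ ↥(maximalRealSubfield (F : Type)) (F : Type) (IsCMField.complexConj (F : Type)) Jstar
            (IsCMField.complexConj_ne_one (F : Type)) (UnitaryGroup.complexConj_smul_infinitePlace (F : Type))
            (cmPlace (F : Type) ι₁) 𝔣) ∧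
            (Literature.AlgebraicGeometry.HodgeTheory.IsOfHodgeType ((sec42DataGS S h4 isoₛ).A K).dim
                (((sec42DataGS S h4 isoₛ).A K).baseChange ℂ).X 1 0 1 y → r (B.b K y) ∈ (holCotForms₂ ↥(maximalRealSubfield (F : Type)) (F : Type) (IsCMField.complexConj (F : Type)) Jstar
            (IsCMField.complexConj_ne_one (F : Type)) (UnitaryGroup.complexConj_smul_infinitePlace (F : Type))
            (cmPlace (F : Type) ι₁) 𝔣).map (conjFun₂ ↥(maximalRealSubfield (F : Type)) (F : Type) (IsCMField.complexConj (F : Type)) Jstar))) := by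
  intro F ι₁ Jstar K₀ S hU7ₛ h4 isoₛ H _ _ rhoB B 𝔣
  obtain ⟨tr, htri, htrh, htrt⟩ :=
    BettiLevelRecordTransportHodge.exists_bettiLevelRecordTransport_hodge S hU7ₛ h4 isoₛ hA1
  obtain ⟨f, hmem, hinj, hhecke, htyp⟩ := hL F ι₁ Jstar K₀ S hU7ₛ h4 isoₛ 𝔣 tr htri htrh
  obtain ⟨r, hrinj, hrmem, hreq, hrlev⟩ := B.exists_realisation_of_levelFamily
    (rightRep₂ ↥(maximalRealSubfield (F : Type)) (F : Type) (IsCMField.complexConj (F : Type)) Jstar) f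
    (cohForms₂ ↥(maximalRealSubfield (F : Type)) (F : Type) (IsCMField.complexConj (F : Type)) Jstar
      (IsCMField.complexConj_ne_one (F : Type)) (UnitaryGroup.complexConj_smul_infinitePlace (F : Type))
      (cmPlace (F : Type) ι₁) 𝔣)
    hmem hinj hhecke
  refine ⟨r, hrinj, hrmem, hreq, ?_⟩
  intro K y
  rw [hrlev K y]
  exact ⟨fun he => ⟨fun hy => ((htyp K y).1 he).2 (htrt K y 1 0 hy), fun hy => ((htyp K y).1 he).1 (htrt K y 0 1 hy)⟩,
    fun he => ⟨fun hy => ((htyp K y).2 he).2 (htrt K y 1 0 hy), fun hy => ((htyp K y).2 he).1 (htrt K y 0 1 hy)⟩⟩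


/-! ## §2 (v2) `hL` discharged by ★ (T2′) -/

set_option maxHeartbeats 400000 in  -- same instance-path defeq as §1
/-- **`stub_S1_realisationHodge` MODULO (A1) ALONE**: §1 fed with ★ (T2′) `S1LevelRealisationTyped.levelRealisation_of_transport` (p798192:
the typed levelwise realisation `f_K = (Φ_K + conj ∘ Φ_K ∘ conj) ∘ tr_K` of ANY injective Hecke-natural transport).  Conclusion = the TYPE of
`stub_S1_realisationHodge : S1RealisationHodgeShape` (`Lines/F0_AlbCmS1bHodge.lean` ED. 2 ff31971c :84–:119) TOKEN FOR TOKEN; the line's ED. 3 reads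
`theorem stub_S1_realisationHodge : S1RealisationHodgeShape := F0AlbCmS1RealisationHodge.stub_S1_realisationHodge_of_A1 stub_A1`.
[cite: Liu2021, §D.2 (D.1) l. 5300–5359; §4.2 l. 2074–2081] [cite: Deligne1979Valeurs, 0.2.5 (p. 315)] [cite: VoisinHodgeI2002, Cor. 7.6 and §7.3.2] -/
theorem stub_S1_realisationHodge_of_A1 (hA1 : ConjEmbedding.isOfHodgeType_conj_iff) :
    ∀ (F : CMField) (ι₁ : F →+* ℂ) (Jstar : Matrix (Fin 2) (Fin 2) (F : Type))
      (K₀ : C5.OpenCompactSubgroup ↥(finAdelic ↥(maximalRealSubfield (F : Type)) (F : Type) (IsCMField.complexConj (F : Type)) 2 Jstar))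
      (S : RecordSystemGS (F : Type) Jstar ι₁ K₀) (hU7ₛ : S.HeckeTranslateDefinedOver)
      (h4 : 4 ≤ Module.finrank ℚ (F : Type)) (isoₛ : ℕ → Prop)
      (H : Type) [AddCommGroup H] [Module ℂ H] (rhoB : Representation ℂ (sec42DataGS S h4 isoₛ).G H)
      (B : (sec42DataGS S h4 isoₛ).BettiPinning (sec42HeckeTranslatesGS S hU7ₛ h4 isoₛ) ι₁ H rhoB)
      (𝔣 : ConeFrame (F : Type) Jstar (cmPlace (F : Type) ι₁)),
      ∃ r : H →ₗ[ℂ] ((adelicGroupData ↥(maximalRealSubfield (F : Type)) (F : Type) (IsCMField.complexConj (F : Type)) 2 Jstar).Adelic → ℂ),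
        Function.Injective r ∧
        (∀ x : H, r x ∈ cohForms₂ ↥(maximalRealSubfield (F : Type)) (F : Type) (IsCMField.complexConj (F : Type)) Jstar
            (IsCMField.complexConj_ne_one (F : Type)) (UnitaryGroup.complexConj_smul_infinitePlace (F : Type))
            (cmPlace (F : Type) ι₁) 𝔣) ∧
        (∀ (g : (sec42DataGS S h4 isoₛ).G) (x : H),
          r (rhoB g x) = rightRep₂ ↥(maximalRealSubfield (F : Type)) (F : Type) (IsCMField.complexConj (F : Type)) Jstar g (r x)) ∧
        letI : Algebra (F : Type) ℂ := algebraAlong (F : Type) ι₁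
        ∀ (K : C5.SmallLevel K₀) (y : (sec42DataGS S h4 isoₛ).bettiH1 ι₁ K),
          ((cmPlace (F : Type) ι₁).1.embedding = ι₁ →
            (Literature.AlgebraicGeometry.HodgeTheory.IsOfHodgeType ((sec42DataGS S h4 isoₛ).A K).dim
                (((sec42DataGS S h4 isoₛ).A K).baseChange ℂ).X 1 1 0 y → r (B.b K y) ∈ (holCotForms₂ ↥(maximalRealSubfield (F : Type)) (F : Type) (IsCMField.complexConj (F : Type)) Jstar
            (IsCMField.complexConj_ne_one (F : Type)) (UnitaryGroup.complexConj_smul_infinitePlace (F : Type))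
            (cmPlace (F : Type) ι₁) 𝔣).map (conjFun₂ ↥(maximalRealSubfield (F : Type)) (F : Type) (IsCMField.complexConj (F : Type)) Jstar)) ∧
            (Literature.AlgebraicGeometry.HodgeTheory.IsOfHodgeType ((sec42DataGS S h4 isoₛ).A K).dim
                (((sec42DataGS S h4 isoₛ).A K).baseChange ℂ).X 1 0 1 y → r (B.b K y) ∈ holCotForms₂ ↥(maximalRealSubfield (F : Type)) (F : Type) (IsCMField.complexConj (F : Type)) Jstar
            (IsCMField.complexConj_ne_one (F : Type)) (UnitaryGroup.complexConj_smul_infinitePlace (F : Type))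
            (cmPlace (F : Type) ι₁) 𝔣)) ∧
          ((cmPlace (F : Type) ι₁).1.embedding ≠ ι₁ →
            (Literature.AlgebraicGeometry.HodgeTheory.IsOfHodgeType ((sec42DataGS S h4 isoₛ).A K).dim
                (((sec42DataGS S h4 isoₛ).A K).baseChange ℂ).X 1 1 0 y → r (B.b K y) ∈ holCotForms₂ ↥(maximalRealSubfield (F : Type)) (F : Type) (IsCMField.complexConj (F : Type)) Jstar
            (IsCMField.complexConj_ne_one (F : Type)) (UnitaryGroup.complexConj_smul_infinitePlace (F : Type))
            (cmPlace (F : Type) ι₁) 𝔣) ∧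
            (Literature.AlgebraicGeometry.HodgeTheory.IsOfHodgeType ((sec42DataGS S h4 isoₛ).A K).dim
                (((sec42DataGS S h4 isoₛ).A K).baseChange ℂ).X 1 0 1 y → r (B.b K y) ∈ (holCotForms₂ ↥(maximalRealSubfield (F : Type)) (F : Type) (IsCMField.complexConj (F : Type)) Jstar
            (IsCMField.complexConj_ne_one (F : Type)) (UnitaryGroup.complexConj_smul_infinitePlace (F : Type))
            (cmPlace (F : Type) ι₁) 𝔣).map (conjFun₂ ↥(maximalRealSubfield (F : Type)) (F : Type) (IsCMField.complexConj (F : Type)) Jstar))) :=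
  stub_S1_realisationHodge_of hA1 S1LevelRealisationTyped.levelRealisation_of_transport

end Summit.HodgeConjecture.HodgeConjecture.Cruxes.HLiu418.F0AlbCmS1RealisationHodge

end
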